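import Summits.CriticalPhenomena.Ising3D.Control2DTermwise
import Literature.NumberTheory.Automorphic.ZhouLegendreGreenValuesProofs
import Mathlib.Tactic.Linarith
import Mathlib.Tactic.Positivity
import Mathlib.Tactic.FieldSimp
import Mathlib.Tactic.Ring
import HarnessLib

/-!
# The 2D control: the chiral coefficients `a_m(h)` in product form — non-negative and non-decreasing in `h`
(cell `pub-ising3x`, seat controls-1; mathematics of the kernel checker for obligation (C))

HONEST FRAMING: lottery ticket; floor = tightest certified 3D Ising CFT bounds; no exact-solution
claim without a proof.

The coefficient `a_m(h) = (h)_m² / (m! (2h)_m)` of `x^{h+m}` in the chiral block `k_{2h}(x)`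
(`Control2DTermwise.chiralCoeff h m`, Mathlib's `ordinaryHypergeometricCoefficient h h (2h) m`) is the
product `∏_{i<m} φ_i(h)`, `φ_0(h) = h/2`, `φ_i(h) = (h+i)² / ((i+1)(2h+i))` (`i ≥ 1`), for `h ≥ 0`
(`chiralCoeff_eq_prod`, from the tree's coefficient recurrence). Each factor is non-negative and
NON-DECREASING on `h ≥ 0` (`(h₂+i)²(2h₁+i) - (h₁+i)²(2h₂+i) = (h₂-h₁)(2(h₁+i)h₁ + (h₂-h₁)(2h₁+i)) ≥ 0`),
hence so is `a_m(h)` (`chiralCoeff_mono`) — the monotonicity verifier B's `mono` method uses — and so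
are the truncated chiral series `AN N h v = Σ_{m<N} a_m(h) v^m` (`v ≥ 0`) and the block factor
`brR N ℓ Δ x y = (x/y)^{ℓ/2} AN(h;x) AN(h̄;y) + (y/x)^{ℓ/2} AN(h̄;x) AN(h;y)`, `h = (Δ+ℓ)/2`,
`h̄ = (Δ-ℓ)/2`, as a function of `Δ ≥ ℓ` (`brR_nonneg`, `brR_mono`). This is what the kernel cell
scheme for obligation (C) needs from the blocks besides the convexity of `Δ ↦ (xy)^{Δ/2}`.

References: Dolan–Osborn 2004 §3 (the blocks); Andrews–Askey–Roy 1999 §2.3 via the tree's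
`LegendreP.ordinaryHypergeometricCoefficient_succ_rec`; verifier B `checkB_points2d.py` method
`mono` (pub-ising3x controls-1 gen 3). [folklore]
-/

namespace Summit.CriticalPhenomena.Ising3D.Control2D

open Finset
open Literature.MathematicalPhysics.QuantumFieldTheory.ConformalBootstrap3D

/-! ### The factors -/

/-- The `i`-th factor of `a_m(h)`: `φ_0(h) = h/2`, `φ_i(h) = (h+i)²/((i+1)(2h+i))`. [folklore] -/
noncomputable def chiralFactor (i : ℕ) (h : ℝ) : ℝ :=
  if i = 0 then h / 2 else (h + i) ^ 2 / (((i : ℝ) + 1) * (2 * h + i))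

/-- The product form `∏_{i<m} φ_i(h)`. [folklore] -/
noncomputable def chiralProd (h : ℝ) (m : ℕ) : ℝ := ∏ i ∈ range m, chiralFactor i h

/-- For `h > 0` every factor equals `(h+i)²/((i+1)(2h+i))` (also `i = 0`). [folklore] -/
theorem chiralFactor_eq_of_pos {h : ℝ} (hh : 0 < h) (i : ℕ) :
    chiralFactor i h = (h + i) ^ 2 / (((i : ℝ) + 1) * (2 * h + i)) := by
  unfold chiralFactor
  split_ifs with hi
  · subst hi; simp; field_simp
  · rfl

/-- `φ_i(h) ≥ 0` for `h ≥ 0`. [folklore] -/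
theorem chiralFactor_nonneg (i : ℕ) {h : ℝ} (hh : 0 ≤ h) : 0 ≤ chiralFactor i h := by
  unfold chiralFactor
  split_ifs
  · positivity
  · positivity

/-- `φ_i` is non-decreasing on `h ≥ 0`. [folklore] -/
theorem chiralFactor_mono (i : ℕ) {h₁ h₂ : ℝ} (h0 : 0 ≤ h₁) (h12 : h₁ ≤ h₂) :
    chiralFactor i h₁ ≤ chiralFactor i h₂ := by
  unfold chiralFactor
  split_ifs with hi
  · linarith
  · have hi1 : (1 : ℝ) ≤ i := by
      have : 1 ≤ i := Nat.one_le_iff_ne_zero.mpr hi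
      exact_mod_cast this
    have h02 : 0 ≤ h₂ := h0.trans h12
    have hd1 : 0 < ((i : ℝ) + 1) * (2 * h₁ + i) := by positivity
    have hd2 : 0 < ((i : ℝ) + 1) * (2 * h₂ + i) := by positivity
    rw [div_le_div_iff₀ hd1 hd2]
    have hd : 0 ≤ h₂ - h₁ := by linarith
    have hi0 : (0 : ℝ) ≤ i := by positivity
    nlinarith [mul_nonneg (mul_nonneg hd (by linarith : 0 ≤ h₁ + i)) h0,
      mul_nonneg (mul_nonneg hd hd) (by linarith : 0 ≤ 2 * h₁ + i),
      mul_nonneg hd h0, mul_nonneg hd hi0]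

/-- `∏_{i<m} φ_i(h) ≥ 0` for `h ≥ 0`. [folklore] -/
theorem chiralProd_nonneg {h : ℝ} (hh : 0 ≤ h) (m : ℕ) : 0 ≤ chiralProd h m :=
  prod_nonneg fun i _ => chiralFactor_nonneg i hh

/-- The product form is non-decreasing in `h ≥ 0`. [folklore] -/
theorem chiralProd_mono {h₁ h₂ : ℝ} (h0 : 0 ≤ h₁) (h12 : h₁ ≤ h₂) (m : ℕ) :
    chiralProd h₁ m ≤ chiralProd h₂ m :=
  prod_le_prod (fun i _ => chiralFactor_nonneg i h0) fun i _ => chiralFactor_mono i h0 h12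

/-! ### `a_m(h)` is the product -/

/-- `a_m(0) = [m = 0]` (the Pochhammer symbol `(0)_m` vanishes for `m ≥ 1`). [folklore] -/
theorem chiralCoeff_zero_left (m : ℕ) : chiralCoeff 0 m = if m = 0 then 1 else 0 := by
  unfold chiralCoeff ordinaryHypergeometricCoefficient
  split_ifs with hm
  · subst hm; simp
  · rw [ascPochhammer_eval_zero, if_neg hm]; simp

/-- **Product form**: `a_m(h) = ∏_{i<m} φ_i(h)` for `h ≥ 0`. [folklore] -/
theorem chiralCoeff_eq_prod {h : ℝ} (hh : 0 ≤ h) (m : ℕ) : chiralCoeff h m = chiralProd h m := by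
  rcases hh.lt_or_eq with hpos | hzero
  · induction m with
    | zero => simp [chiralCoeff, ordinaryHypergeometricCoefficient, chiralProd]
    | succ n ih =>
      have hrec := Literature.NumberTheory.Automorphic.LegendreP.ordinaryHypergeometricCoefficient_succ_rec
        h h (2 * h) n (by positivity)
      have hc : chiralCoeff h (n + 1) =
          chiralCoeff h n * ((h + n) ^ 2 / (((n : ℝ) + 1) * (2 * h + n))) := by
        unfold chiralCoeff
        generalize ordinaryHypergeometricCoefficient h h (2 * h) (n + 1) = A1 at hrec ⊢
        generalize ordinaryHypergeometricCoefficient h h (2 * h) n = A0 at hrec ⊢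
        rw [mul_div_assoc', eq_div_iff (by positivity)]
        linear_combination hrec
      rw [hc, ih, chiralProd, chiralProd, prod_range_succ, chiralFactor_eq_of_pos hpos n]
  · subst hzero
    rw [chiralCoeff_zero_left]
    split_ifs with hm
    · subst hm; simp [chiralProd]
    · have h0 : 0 ∈ range m := by simp; omega
      unfold chiralProd
      rw [prod_eq_zero h0]
      simp [chiralFactor]

/-- **`a_m(h)` is non-decreasing in `h ≥ 0`.** [folklore] -/
theorem chiralCoeff_mono {h₁ h₂ : ℝ} (h0 : 0 ≤ h₁) (h12 : h₁ ≤ h₂) (m : ℕ) :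
    chiralCoeff h₁ m ≤ chiralCoeff h₂ m := by
  rw [chiralCoeff_eq_prod h0, chiralCoeff_eq_prod (h0.trans h12)]
  exact chiralProd_mono h0 h12 m

/-! ### The truncated chiral series and the block factor -/

/-- The truncated chiral series `AN N h v = Σ_{m<N} a_m(h) v^m` (so `k_{2h}(x) ≈ x^h AN N h x`).
[folklore] -/
noncomputable def AN (N : ℕ) (h v : ℝ) : ℝ := ∑ m ∈ range N, chiralCoeff h m * v ^ m

/-- `AN ≥ 0` for `h, v ≥ 0`. [folklore] -/
theorem AN_nonneg (N : ℕ) {h v : ℝ} (hh : 0 ≤ h) (hv : 0 ≤ v) : 0 ≤ AN N h v :=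
  sum_nonneg fun m _ => mul_nonneg (chiralCoeff_nonneg hh m) (pow_nonneg hv m)

/-- `AN` is non-decreasing in `h ≥ 0` (`v ≥ 0`). [folklore] -/
theorem AN_mono (N : ℕ) {h₁ h₂ v : ℝ} (h0 : 0 ≤ h₁) (h12 : h₁ ≤ h₂) (hv : 0 ≤ v) :
    AN N h₁ v ≤ AN N h₂ v :=
  sum_le_sum fun m _ => mul_le_mul_of_nonneg_right (chiralCoeff_mono h0 h12 m) (pow_nonneg hv m)

/-- The truncated block factor at spin `ℓ` (even; `ℓ/2` a natural):
`brR N ℓ Δ x y = (x/y)^{ℓ/2} AN(h;x) AN(h̄;y) + (y/x)^{ℓ/2} AN(h̄;x) AN(h;y)`, `h = (Δ+ℓ)/2`,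
`h̄ = (Δ-ℓ)/2`; the truncated parity-symmetrised block is `(xy)^{Δ/2} · brR`. [folklore] -/
noncomputable def brR (N ℓ : ℕ) (Δ x y : ℝ) : ℝ :=
  (x / y) ^ (ℓ / 2) * AN N ((Δ + ℓ) / 2) x * AN N ((Δ - ℓ) / 2) y +
    (y / x) ^ (ℓ / 2) * AN N ((Δ - ℓ) / 2) x * AN N ((Δ + ℓ) / 2) y

/-- `brR ≥ 0` for `Δ ≥ ℓ`, `x, y > 0`. [folklore] -/
theorem brR_nonneg (N ℓ : ℕ) {Δ x y : ℝ} (hΔ : (ℓ : ℝ) ≤ Δ) (hx : 0 < x) (hy : 0 < y) :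
    0 ≤ brR N ℓ Δ x y := by
  have hℓ : (0 : ℝ) ≤ ℓ := Nat.cast_nonneg ℓ
  have h1 : 0 ≤ (Δ + ℓ) / 2 := by linarith
  have h2 : 0 ≤ (Δ - ℓ) / 2 := by linarith
  unfold brR
  have := AN_nonneg N h1 hx.le; have := AN_nonneg N h2 hy.le
  have := AN_nonneg N h2 hx.le; have := AN_nonneg N h1 hy.le
  positivity

/-- **`brR` is non-decreasing in `Δ` on `Δ ≥ ℓ`** (`x, y > 0`). [folklore] -/
theorem brR_mono (N ℓ : ℕ) {Δ₁ Δ₂ x y : ℝ} (hΔ : (ℓ : ℝ) ≤ Δ₁) (h12 : Δ₁ ≤ Δ₂) (hx : 0 < x)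
    (hy : 0 < y) : brR N ℓ Δ₁ x y ≤ brR N ℓ Δ₂ x y := by
  have hℓ : (0 : ℝ) ≤ ℓ := Nat.cast_nonneg ℓ
  have a1 : 0 ≤ (Δ₁ + ℓ) / 2 := by linarith
  have a2 : 0 ≤ (Δ₁ - ℓ) / 2 := by linarith
  have m1 : (Δ₁ + ℓ) / 2 ≤ (Δ₂ + ℓ) / 2 := by linarith
  have m2 : (Δ₁ - ℓ) / 2 ≤ (Δ₂ - ℓ) / 2 := by linarith
  unfold brR
  have p1 := AN_mono N a1 m1 hx.le; have p2 := AN_mono N a2 m2 hy.le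
  have p3 := AN_mono N a2 m2 hx.le; have p4 := AN_mono N a1 m1 hy.le
  have n1 := AN_nonneg N a1 hx.le; have n2 := AN_nonneg N a2 hy.le
  have n3 := AN_nonneg N a2 hx.le; have n4 := AN_nonneg N a1 hy.le
  have r1 : 0 ≤ (x / y) ^ (ℓ / 2) := by positivity
  have r2 : 0 ≤ (y / x) ^ (ℓ / 2) := by positivity
  have q1 := mul_le_mul p1 p2 n2 (n1.trans p1)
  have q2 := mul_le_mul p3 p4 n4 (n3.trans p3)
  have := mul_le_mul_of_nonneg_left q1 r1
  have := mul_le_mul_of_nonneg_left q2 r2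
  nlinarith

end Summit.CriticalPhenomena.Ising3D.Control2D
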